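import Literature.MathematicalPhysics.QuantumFieldTheory.Balaban1983to89.B13FirstEstimate215
import Literature.MathematicalPhysics.QuantumFieldTheory.Balaban1983to89.B13CauchyDecay

/-!
# `Balaban1983to89.B13FirstEstimate215Assembled` — T. Bałaban, *Renormalization group approach to lattice gauge field
theories. II. Cluster expansions*, Commun. Math. Phys. **116** (1988) 1–22 [Balaban1988RG2Cluster], p. 15: the «first
estimate» (2.15) of the generic term (2.14) AS ONE DISPLAY for the typed objects of record — line 1 (the Cauchy
prefactors `exp(−(κ₁ − 1)(LM)⁻⁴|Z∖Z′₀|) Π_{Y∈𝐃} 2/|τ(Y)|`, `B13CauchyDecay.norm_term214_le_215`) TIMES lines 2–4 (the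
modulus of the complex Gaussian integrals at the contour parameters, `B13FirstEstimate215.norm_core214_F214_le_215`),
which the tree held so far only as the two separate pieces.

statement-level skeleton of published theorems with citation tags; proofs where landed; nothing here is a claim about
the Yang–Mills mass gap

PDF held: `paper:balaban1988-cmp116-rg-ii-cluster` (journal page = PDF page + 0); p. 15 re-read this session from the
materialised text `p0015.txt`, the render `pub-balaban/b2b-balaban-ref1/pages/1988-cmp116-rg-II-cluster/…-p016-x2.png`
(for (2.16)) and the cell transcript `pub-balaban/b2b-balaban-b13/transcript-B13.md` ll. 146–149.

CITATION HEADER (verbatim, p. 15 [PDF 15]): *"We consider it as an analytic function of (𝐔, 𝐉) in the space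
U^c_{k+1}(X, α₀, α₁), and of the complex parameters σ(Z), τ. This complicates estimates of this expression, because the
operators in it are not symmetric, and the second measure is complex. … The first estimate is*
`|(7.14)| ≦ exp(−(κ₁ − 1)(LM)⁻⁴|Z∖Z′₀|) Π_{Y∈𝐃} 2/|τ(Y)| · ∫dμ₀(X)|_Z exp(−½Re⟨Γ_k(Z₀,σ(Z))X, C^{(k)}(Z₀,σ(Z))Γ_k(Z₀,σ(Z))X⟩)`
`  · |det(C^{(k)}(Z₀,σ(Z))⁻¹)/det(Re C^{(k)}(Z₀,σ(Z))⁻¹)|^{1/2} ∫dμ_{(Re C^{(k)}(Z₀,σ(Z))⁻¹)⁻¹}(B) exp(−⟨B, Re Γ_k(Z₀,σ(Z))X⟩)`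
`  · χ_{k,Y₀}χᶜ_{k,P} exp[Σ_{Y∈𝐃} |τ(Y)||𝐕_k(Y,B)|].`  (2.15)  [label slip «(7.14)» for (2.14)] *"In the expression on the
right-hand side we replace the operators by the corresponding operators with σ(Z) = 0, 𝐔 = U, 𝐉 = 0, and we estimate
the error."*

WHAT IS REPRODUCED (unit `lit-balaban-r10` gen 11, B13 fold owner; SKELETON row `B13.Eq2.15` of
`HOME/lit-balaban-r10/ROWS-B13.md`, HOME = `run/shared/lean/pub/lit-balaban/`, whose head reads «proved-existing (pieces) ·
absent (assembly, schematic)»; rows B13.Eq2.14 / B13.Eq2.26 adjacent).  **`norm_term214_le_215_assembled`**: for the typed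
generic term (2.14) `B13Term214.term214 r lZ lD (core214 A Γ (F214 …)) σ₀ τ₀` — `A(σ) = C^{(k)}(Z₀,σ)⁻¹` the complex
precision, `Γ(σ) = Γ_k(Z₀,σ)`, last line `F214` = `(−1)^{|P|}χ_{k,Y₀}χᶜ_{k,P}exp[Στ(Y)𝐕_k(Y,·)]`, σ-parameters `lZ` (the
LM-cubes of `Z∖Z′₀`), τ-parameters `lD` (the domains of `𝐃`), base points in the unit polydiscs — separately holomorphic in
`σ` on an open `Uσ ⊇ {|σ| ≤ e^{κ₁}}` (`κ₁ ≥ 1`) and in `τ` on an open `Uτ ⊇ {|τ| ≤ R_τ(Y)}`, `R_τ(Y) ≥ 2`, with `A(σ)`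
symmetric and `Re A(σ) ≻ 0` on the σ-polydisc (the perturbative regime of p. 16):
`|(2.14)| ≤ exp(−(κ₁ − 1)|lZ|) · [Π_{Y∈𝐃} 2/R_τ(Y)] · S` for EVERY common bound `S` of the right-hand side of (2.15) after
its first line — the real number `RHS₂₋₄(σ, τ) = ∫dμ₀(X)|_Z e^{−½Re⟨Γ(σ)X, A(σ)⁻¹Γ(σ)X⟩}·|det A(σ)/det Re A(σ)|^{1/2}·
∫dμ_{(Re A(σ))⁻¹}(B) e^{−⟨B, Re Γ(σ)X⟩} χ_{k,Y₀}χᶜ_{k,P} e^{Σ|τ(Y)||𝐕_k(Y,B)|}` spelled with the tree's `gaussMean` — over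
the two closed parameter polydiscs (the contours of the Cauchy formulae); `norm_term214_le_215_assembled_218` = the same
at the τ-radii (2.18) with the printed bracket `Π 2·invTau`.  READING recorded: print writes the right side of (2.15) at
«the» parameters σ(Z), τ; after the Cauchy formulae of line 1 these range over the contours, so the display bounds
|(2.14)| by line 1 times the supremum of lines 2–4 over the contours — stated here as «for every common majorant S»,
which needs no `sSup`.  The integrability of the two printed majorants (in `B`, and in `X`) is carried as the hypotheses
`hg`, `hX` at each contour point, exactly as in `B13FirstEstimate215.norm_core214_F214_le_215` (they are discharged for
the Gaussian majorant of the replacement step in `B13Replacement223` §7, not needed here).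
HONEST SCOPE.  Assembly of two landed pieces; nothing new analytically.  The (2.14)-representation of H(Z)
(`B13Representation214`), analyticity in (σ, τ), `Re A(σ) ≻ 0` (from (2.16), L16a) stay inputs.  No `sorry`, no
definition, no new named fact (D-0026).
-/

noncomputable section

namespace Literature.MathematicalPhysics.QuantumFieldTheory.Balaban1983to89.B13FirstEstimate215Assembled

open Complex MeasureTheory Metric Finset Matrix
open B13GaugeDevices (gaussWeight gaussMean)
open B13Term214 (SepHolOn term214 core214 integrand214 cgaussMean F214)
open B13FirstEstimate215 (norm_core214_F214_le_215)
open B13CauchyDecay (norm_term214_le_215 norm_term214_le_226)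
open B13Bound143 (invTau)

variable {Λ : Type} [Fintype Λ] [DecidableEq Λ] {C₀ : Type} [Fintype C₀] [DecidableEq C₀]
variable {ι κ : Type*} [DecidableEq ι] [DecidableEq κ]

/-- **(2.15) — the «first estimate», assembled as one display** for the typed term (2.14): if on the two closed parameter
polydiscs (`|σ(Δ)| ≤ e^{κ₁}`, `|τ(Y)| ≤ R_τ(Y)`) the precision `A(σ)` is symmetric with `Re A(σ) ≻ 0`, the two printed
majorants are integrable (`hg`: in `B` against the weight of `Re A(σ)`; `hX`: in `X` against `dμ₀`), and the right-hand
side of (2.15) after its first line,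
`∫dμ₀(X)|_Z e^{−½Re⟨Γ(σ)X, A(σ)⁻¹Γ(σ)X⟩} |det A(σ)/det Re A(σ)|^{1/2} ∫dμ_{(Re A(σ))⁻¹}(B) e^{−⟨B,Re Γ(σ)X⟩} χ_{k,Y₀}χᶜ_{k,P} e^{Σ_{Y}|τ(Y)||𝐕_k(Y,B)|}`,
is `≤ S` there, and `∫dμ₀(X)|_Z (lines 2–4 of (2.14))` is separately holomorphic in σ on `Uσ ⊇ {|σ| ≤ e^{κ₁}}` (`κ₁ ≥ 1`) and
in τ on `Uτ ⊇ {|τ| ≤ R_τ(Y)}` (`R_τ(Y) ≥ 2`), then for base points in the unit polydiscs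
`|(2.14)| ≤ exp(−(κ₁ − 1)|lZ|) · [Π_{Y∈𝐃} 2/R_τ(Y)] · S` — line 1 (`B13CauchyDecay.norm_term214_le_215`) times lines 2–4
(`B13FirstEstimate215.norm_core214_F214_le_215`). [cite: Balaban1988RG2Cluster, (2.15) p.15] -/
theorem norm_term214_le_215_assembled {κ₁ : ℝ} (hκ₁ : 1 ≤ κ₁) (Rτ : κ → ℝ) (hRτ : ∀ Y, 2 ≤ Rτ Y)
    {Uσ Uτ : Set ℂ} (hUσ : IsOpen Uσ) (hUτ : IsOpen Uτ) (hUexp : closedBall (0 : ℂ) (Real.exp κ₁) ⊆ Uσ)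
    (hUtau : ∀ Y, closedBall (0 : ℂ) (Rτ Y) ⊆ Uτ) {r : ℝ} (hr : 0 < r) (hr' : r ≤ Real.exp κ₁ - 1)
    (hsubτ : ∀ s ∈ Set.uIcc (0 : ℝ) 1, closedBall (s : ℂ) r ⊆ Uτ)
    (A : (ι → ℂ) → Matrix Λ Λ ℂ) (Γ : (ι → ℂ) → (Λ ⊕ C₀ → ℝ) → (Λ → ℂ))
    (cardP : ℕ) (χY₀ χcP : (Λ → ℝ) → ℝ) (hχ0 : ∀ B, 0 ≤ χY₀ B) (hχc0 : ∀ B, 0 ≤ χcP B) (Dfam : Finset κ)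
    (V : κ → (Λ → ℝ) → ℂ)
    (hΨσ : ∀ τ : κ → ℂ, (∀ j, τ j ∈ Uτ) → SepHolOn Uσ (fun σ => core214 A Γ (F214 cardP χY₀ χcP Dfam V) σ τ))
    (hΨτ : ∀ σ : ι → ℂ, (∀ j, σ j ∈ Uσ) → SepHolOn Uτ (fun τ => core214 A Γ (F214 cardP χY₀ χcP Dfam V) σ τ))
    (hAs : ∀ σ : ι → ℂ, (∀ j, ‖σ j‖ ≤ Real.exp κ₁) → (A σ).IsSymm)
    (hA : ∀ σ : ι → ℂ, (∀ j, ‖σ j‖ ≤ Real.exp κ₁) → ((A σ).map Complex.re).PosDef)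
    (hg : ∀ (σ : ι → ℂ) (τ : κ → ℂ), (∀ j, ‖σ j‖ ≤ Real.exp κ₁) → (∀ Y, ‖τ Y‖ ≤ Rτ Y) →
      ∀ X : Λ ⊕ C₀ → ℝ, Integrable (fun B : Λ → ℝ =>
        gaussWeight ((A σ).map Complex.re) B * (Real.exp (-(B ⬝ᵥ fun i => (Γ σ X i).re))
          * (χY₀ B * χcP B * Real.exp (∑ Y ∈ Dfam, ‖τ Y‖ * ‖V Y B‖)))))
    (hX : ∀ (σ : ι → ℂ) (τ : κ → ℂ), (∀ j, ‖σ j‖ ≤ Real.exp κ₁) → (∀ Y, ‖τ Y‖ ≤ Rτ Y) →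
      Integrable (fun X : Λ ⊕ C₀ → ℝ => gaussWeight (1 : Matrix (Λ ⊕ C₀) (Λ ⊕ C₀) ℝ) X *
        (Real.exp (-(1 / 2) * ((Γ σ X) ⬝ᵥ ((A σ)⁻¹ *ᵥ Γ σ X)).re)
          * (Real.sqrt (‖(A σ).det‖ / ((A σ).map Complex.re).det)
            * gaussMean ((A σ).map Complex.re) (fun B => Real.exp (-(B ⬝ᵥ fun i => (Γ σ X i).re))
              * (χY₀ B * χcP B * Real.exp (∑ Y ∈ Dfam, ‖τ Y‖ * ‖V Y B‖)))))))
    {S : ℝ}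
    (hS : ∀ (σ : ι → ℂ) (τ : κ → ℂ), (∀ j, ‖σ j‖ ≤ Real.exp κ₁) → (∀ Y, ‖τ Y‖ ≤ Rτ Y) →
      gaussMean (1 : Matrix (Λ ⊕ C₀) (Λ ⊕ C₀) ℝ) (fun X =>
          Real.exp (-(1 / 2) * ((Γ σ X) ⬝ᵥ ((A σ)⁻¹ *ᵥ Γ σ X)).re)
            * (Real.sqrt (‖(A σ).det‖ / ((A σ).map Complex.re).det)
              * gaussMean ((A σ).map Complex.re) (fun B => Real.exp (-(B ⬝ᵥ fun i => (Γ σ X i).re))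
                * (χY₀ B * χcP B * Real.exp (∑ Y ∈ Dfam, ‖τ Y‖ * ‖V Y B‖))))) ≤ S)
    {lZ : List ι} (hlZ : lZ.Nodup) {lD : List κ} (hlD : lD.Nodup)
    {σ₀ : ι → ℂ} (hσ₀ : ∀ j, ‖σ₀ j‖ ≤ 1) {τ₀ : κ → ℂ} (hτ₀ : ∀ Y, ‖τ₀ Y‖ ≤ 1) :
    ‖term214 r lZ lD (core214 A Γ (F214 cardP χY₀ χcP Dfam V)) σ₀ τ₀‖ ≤
      Real.exp (-(κ₁ - 1) * lZ.length) * (∏ Y ∈ lD.toFinset, 2 * (Rτ Y)⁻¹) * S :=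
  norm_term214_le_215 hκ₁ Rτ hRτ hUσ hUτ hUexp hUtau hr hr' hsubτ hΨσ hΨτ
    (fun σ τ hσ hτ =>
      (norm_core214_F214_le_215 (hAs σ hσ) (hA σ hσ) (Γ σ) cardP χY₀ χcP hχ0 hχc0 Dfam V τ (hg σ τ hσ hτ)
        (hX σ τ hσ hτ)).trans (hS σ τ hσ hτ))
    hlZ hlD hσ₀ hτ₀

/-- **(2.15) at the τ-radii (2.18)** — `|τ(Y)| = (invTau cst (d_k Y))⁻¹` (`0 < invTau ≤ ½`), σ-radius `e^{κ₁}`,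
`κ₁ = cst.κ₁ ≥ 1`: `|(2.14)| ≤ exp(−(κ₁ − 1)|lZ|) · [Π_{Y∈𝐃} 2·invTau cst (d_k Y)] · S` for every common bound `S` of
the right-hand side of (2.15) after its first line over the two closed polydiscs; the bracket is the printed
`Π_{Y∈𝐃} 2E₀ε₁C₁α₄⁻¹M^q exp C₂κ₁ exp(−(1−3δ)κd_k(Y))` of (2.26). [cite: Balaban1988RG2Cluster, (2.15) p.15, (2.18) p.16] -/
theorem norm_term214_le_215_assembled_218 (cst : B13.Consts) (hκ₁ : 1 ≤ cst.κ₁) (dk : κ → ℝ)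
    (hpos : ∀ Y, 0 < invTau cst (dk Y)) (h2 : ∀ Y, invTau cst (dk Y) ≤ 1 / 2)
    {Uσ Uτ : Set ℂ} (hUσ : IsOpen Uσ) (hUτ : IsOpen Uτ) (hUexp : closedBall (0 : ℂ) (Real.exp cst.κ₁) ⊆ Uσ)
    (hUtau : ∀ Y, closedBall (0 : ℂ) ((invTau cst (dk Y))⁻¹) ⊆ Uτ) {r : ℝ} (hr : 0 < r)
    (hr' : r ≤ Real.exp cst.κ₁ - 1) (hsubτ : ∀ s ∈ Set.uIcc (0 : ℝ) 1, closedBall (s : ℂ) r ⊆ Uτ)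
    (A : (ι → ℂ) → Matrix Λ Λ ℂ) (Γ : (ι → ℂ) → (Λ ⊕ C₀ → ℝ) → (Λ → ℂ))
    (cardP : ℕ) (χY₀ χcP : (Λ → ℝ) → ℝ) (hχ0 : ∀ B, 0 ≤ χY₀ B) (hχc0 : ∀ B, 0 ≤ χcP B) (Dfam : Finset κ)
    (V : κ → (Λ → ℝ) → ℂ)
    (hΨσ : ∀ τ : κ → ℂ, (∀ j, τ j ∈ Uτ) → SepHolOn Uσ (fun σ => core214 A Γ (F214 cardP χY₀ χcP Dfam V) σ τ))
    (hΨτ : ∀ σ : ι → ℂ, (∀ j, σ j ∈ Uσ) → SepHolOn Uτ (fun τ => core214 A Γ (F214 cardP χY₀ χcP Dfam V) σ τ))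
    (hAs : ∀ σ : ι → ℂ, (∀ j, ‖σ j‖ ≤ Real.exp cst.κ₁) → (A σ).IsSymm)
    (hA : ∀ σ : ι → ℂ, (∀ j, ‖σ j‖ ≤ Real.exp cst.κ₁) → ((A σ).map Complex.re).PosDef)
    (hg : ∀ (σ : ι → ℂ) (τ : κ → ℂ), (∀ j, ‖σ j‖ ≤ Real.exp cst.κ₁) → (∀ Y, ‖τ Y‖ ≤ (invTau cst (dk Y))⁻¹) →
      ∀ X : Λ ⊕ C₀ → ℝ, Integrable (fun B : Λ → ℝ =>
        gaussWeight ((A σ).map Complex.re) B * (Real.exp (-(B ⬝ᵥ fun i => (Γ σ X i).re))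
          * (χY₀ B * χcP B * Real.exp (∑ Y ∈ Dfam, ‖τ Y‖ * ‖V Y B‖)))))
    (hX : ∀ (σ : ι → ℂ) (τ : κ → ℂ), (∀ j, ‖σ j‖ ≤ Real.exp cst.κ₁) → (∀ Y, ‖τ Y‖ ≤ (invTau cst (dk Y))⁻¹) →
      Integrable (fun X : Λ ⊕ C₀ → ℝ => gaussWeight (1 : Matrix (Λ ⊕ C₀) (Λ ⊕ C₀) ℝ) X *
        (Real.exp (-(1 / 2) * ((Γ σ X) ⬝ᵥ ((A σ)⁻¹ *ᵥ Γ σ X)).re)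
          * (Real.sqrt (‖(A σ).det‖ / ((A σ).map Complex.re).det)
            * gaussMean ((A σ).map Complex.re) (fun B => Real.exp (-(B ⬝ᵥ fun i => (Γ σ X i).re))
              * (χY₀ B * χcP B * Real.exp (∑ Y ∈ Dfam, ‖τ Y‖ * ‖V Y B‖)))))))
    {S : ℝ}
    (hS : ∀ (σ : ι → ℂ) (τ : κ → ℂ), (∀ j, ‖σ j‖ ≤ Real.exp cst.κ₁) → (∀ Y, ‖τ Y‖ ≤ (invTau cst (dk Y))⁻¹) →
      gaussMean (1 : Matrix (Λ ⊕ C₀) (Λ ⊕ C₀) ℝ) (fun X =>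
          Real.exp (-(1 / 2) * ((Γ σ X) ⬝ᵥ ((A σ)⁻¹ *ᵥ Γ σ X)).re)
            * (Real.sqrt (‖(A σ).det‖ / ((A σ).map Complex.re).det)
              * gaussMean ((A σ).map Complex.re) (fun B => Real.exp (-(B ⬝ᵥ fun i => (Γ σ X i).re))
                * (χY₀ B * χcP B * Real.exp (∑ Y ∈ Dfam, ‖τ Y‖ * ‖V Y B‖))))) ≤ S)
    {lZ : List ι} (hlZ : lZ.Nodup) {lD : List κ} (hlD : lD.Nodup)
    {σ₀ : ι → ℂ} (hσ₀ : ∀ j, ‖σ₀ j‖ ≤ 1) {τ₀ : κ → ℂ} (hτ₀ : ∀ Y, ‖τ₀ Y‖ ≤ 1) :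
    ‖term214 r lZ lD (core214 A Γ (F214 cardP χY₀ χcP Dfam V)) σ₀ τ₀‖ ≤
      Real.exp (-(cst.κ₁ - 1) * lZ.length) * (∏ Y ∈ lD.toFinset, 2 * invTau cst (dk Y)) * S :=
  norm_term214_le_226 cst hκ₁ dk hUσ hUτ hUexp hUtau hr hr' hsubτ hΨσ hΨτ
    (fun σ τ hσ hτ =>
      (norm_core214_F214_le_215 (hAs σ hσ) (hA σ hσ) (Γ σ) cardP χY₀ χcP hχ0 hχc0 Dfam V τ (hg σ τ hσ hτ)
        (hX σ τ hσ hτ)).trans (hS σ τ hσ hτ))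
    hlZ hlD hpos h2 hσ₀ hτ₀

end Literature.MathematicalPhysics.QuantumFieldTheory.Balaban1983to89.B13FirstEstimate215Assembled

end
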